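import Summits.BirchSwinnertonDyer.Rank1Residual.X5.TwoAdicTargetsB
import Summits.BirchSwinnertonDyer.Rank1Residual.X5.TwoAdicTargetsMultKatoInt
import Summits.BirchSwinnertonDyer.Rank1Residual.X5.TwoAdicTargetsMultPubOdd
import HarnessLib

/-!
# Door (34-INT-pinch-ns⁺): `BSD₂(E)` at a NON-SPLIT multiplicative `2` from the Kato datum AT SLACK ONE
# (`KatoDivisibilityAtTwoMultUpTo W 1 f (−1) L`, the `Δ > 0` face of T-KATO2-NSMULT) **plus `μ(X(E/ℚ_∞)) = 0`**

Residual programme `b2b-bsdres`, cell bsd-2adic, seat `bsd-2adic-mult` GEN 7 (sub-problem `Rank1Residual`,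
O1 class-closure at `p = 2`, multiplicative `2`, `E[2]` irreducible). Non-split companion of
`TwoAdicTargetsMultKatoIntSplitPos.lean` (door (34-INT-pinch-split⁺)); tail = door (34-INT-pinch) of
`TwoAdicTargetsMultKatoInt.lean` with the A235-twin glue of `TwoAdicTargetsMultPubOdd.lean`.

## What this file is for

PROOF-KATO2MULT Thm. A gives, for `E/ℚ` non-split multiplicative at `2` with `ρ_{E,2^∞}` surjective,
`X = X(E/ℚ_∞)` torsion and `g ∈ char_Λ X` with `ι g = c_∞ · L` (`L` = THE non-split `2`-adic
`L`-function `IsMultPAdicLFunctionOf f 2 (−1) L`, normalised by `Ω⁺_f`, components included; Kato's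
class is normalised by ONE real cycle): on `Δ < 0` this is T-KATO2-NSMULT and door (34-INT-pinch) closes
`BSD₂(E)` at tier 1; on `Δ > 0` it is the slack-ONE datum `KatoDivisibilityAtTwoMultUpTo W 1 f (−1) L`
(mult-2's binder `hK1` of `Theorems.missingUpperBoundAt_two_nonsplit_of_katoMultUpTo_one_of_even_of_eulerChar`)
and the pinch cannot decide `μ(X) ∈ {0, 1}`. THIS FILE proves that the single missing input is
`μ(X(E/ℚ_∞)) = 0`:

* §1 `mem_charIdeal_of_katoUpToOne_nonsplit_of_mu`: from `g ∈ char X` with `ι g = 2^m · L`, `m ≤ 1`, the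
  integral `L₀` with `ι L₀ = ϖ·L` (INT2-AUTO-ns + `ord₂ ϖ ≥ 0`), `μ(X) = 0` and `μ_an = 0`: `L₀ ∈ char X`
  (`m = 0`: `L₀ = ϖ·g`; `m = 1`: `ϖ·g = 2·L₀ = f_X·b` with `μ(f_X) = 0 = μ(L₀)`, so `μ(b) = 1`,
  `b = 2·pfree b`, `L₀ = f_X·pfree b`).
* §2 the doors `bsdp_two_nonsplit_of_katoUpToOnePinch_of_mu` (`BSDp W 2`) and
  `analyticRank_eq_zero_of_finite_selmer_of_katoUpToOneNonsplitPinch_of_mu` (rank-`0` `2`-converse):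
  `L₀ ∈ char X` is exactly the conclusion of T-KATO2-NSMULT, so `charIdeal_eq_span_of_katoInt_selmerPinch_nonsplit`
  and `missingPPartAt_two_nonsplit_of_charIdeal_eq_span` (A235-twin, `l_v = 2`) finish as on `Δ < 0`.

Scope of record: the 12 non-split `Δ > 0` classes with `E[2]` irreducible, `2 ∥ N`, rank `0` and
`λ_an = s₂ = 2` (eng-2 TABLE-MULT-E2 / kit j250807) — for them `BSD₂(E) ⇐ μ(X(E/ℚ_∞)) = 0` modulo the
displayed inputs; nothing here asserts `μ = 0`.

References: R. Greenberg, LNM 1716 (1999), §4 pp. 112–113, Conj. 1.11, Prop. 4.14; B. Mazur, J. Tate,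
J. Teitelbaum, Invent. Math. 84 (1986) §I.10, §I.14; K. Kato, Astérisque 295 (2004) Thm. 17.4;
L. Washington, GTM 83, §13.2; HOME/mult/PROOF-KATO2MULT.md Thm. A, HOME/mult/PROOF-KATO2SPLIT-ADDENDUM-2.md §A2.3.
-/

set_option autoImplicit false

noncomputable section

open scoped Classical MatrixGroups ModularForm

open CongruenceSubgroup WeierstrassCurve Literature.NumberTheory.EllipticCurves
  Literature.NumberTheory.EllipticCurves.ModularForms
  Literature.NumberTheory.EllipticCurves.Wuthrich2014
  Literature.NumberTheory.EllipticCurves.Rank1Residual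
  Literature.NumberTheory.EllipticCurves.Rank1Residual.Typed
  Literature.NumberTheory.EllipticCurves.Greenberg1999
  Literature.NumberTheory.Transcendental
  Summit.BirchSwinnertonDyer.Rank1Residual.X1.MuLambda
  Summit.BirchSwinnertonDyer.Rank1Residual.X1.MuPart
  Summit.BirchSwinnertonDyer.Rank1Residual.X1.ParitySqueeze

namespace Summit.BirchSwinnertonDyer.Rank1Residual.X5.O1

variable (W : WeierstrassCurve ℚ) [W.IsElliptic] [W.IsGloballyMinimal]

/-! ## §1 From the slack-one datum plus `μ(X) = 0` to the integral divisibility `L₀ ∈ char_Λ X` (pure algebra) -/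

/-- **`L₀ ∈ char_Λ X` from Kato at slack one, GIVEN `μ(X) = 0` (PROVED; pure algebra plus the analytic
`μ`-certificate).** Data at a NON-SPLIT `2`: a cyclotomic dual datum `D` with `X` torsion and `μ(X) = 0`
(`hμX`), `g ∈ char_Λ X` with `ι g = 2^m · L`, `m ≤ 1` (`hιg`, the slack-one datum), an integral `L₀` with
`ι L₀ = ϖ·L` (`hL₀`) where `ϖ = ϖ₀ ∈ ℤ₂` (`hϖ₀`), and `μ_an = 0` (`hμan`, giving `μ(L₀) = 0`). Then
`L₀ ∈ char_Λ X`. Proof: `ι` is injective, so `ϖ₀·g = 2^m·L₀`; if `m = 0` the ideal absorbs `ϖ₀`; if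
`m = 1`, `char X = (f_X)`, `ϖ₀·g = f_X·b = 2·L₀`, `μ(f_X) = μ(X) = 0 = μ(L₀)` force `μ(b) = 1`,
`b = 2·pfree b`, `L₀ = f_X·pfree b`. [cite: Washington1997, §13.2 (after Thm. 13.12)]
[cite: GreenbergVatsal2000, p. 2–4, (1)–(2)] -/
theorem mem_charIdeal_of_katoUpToOne_nonsplit_of_mu
    (hns : ¬ W.HasSplitMultiplicativeReductionAtPrime 2) (hμan : X2.AnalyticMuLE W 2 0)
    {κ : ZpExtension ℚ 2} {γ : Field.absoluteGaloisGroup ℚ} (hγ : κ.IsTopGenerator γ)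
    {N : ℕ} [NeZero N] {f : CuspForm (Gamma0 N) 2} (hf : IsNewformOf W f) {L : PowerSeries ℚ_[2]}
    (hLf : IsMultPAdicLFunctionOf f 2 (-1) L) (D : W.SelmerDualData κ γ) (hX : D.IsTorsion)
    (hμX : D.mu = 0) {ϖ : ℚ} (hϖ : (ϖ : ℝ) * W.realPeriodRat = plusPeriod f) {ϖ₀ : ℤ_[2]}
    (hϖ₀ : (ϖ₀ : ℚ_[2]) = ((ϖ : ℚ) : ℚ_[2])) {g : IwasawaAlgebra 2} (hg : g ∈ D.charIdeal) {m : ℕ}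
    (hm : m ≤ 1) (hιg : iwasawaToPowerSeries 2 g = PowerSeries.C ((2 : ℚ_[2]) ^ m) * L)
    {L₀ : IwasawaAlgebra 2} (hL₀ : iwasawaToPowerSeries 2 L₀ = PowerSeries.C (ϖ : ℚ_[2]) * L) :
    L₀ ∈ D.charIdeal := by
  haveI : Module.Finite (IwasawaAlgebra 2) D.X := D.module_finite_holds hγ
  -- (1) `ϖ₀·g = 2^m·L₀` in `Λ`, by injectivity of `ι`
  have hιC : ∀ c : ℤ_[2], iwasawaToPowerSeries 2 (PowerSeries.C c) = PowerSeries.C (c : ℚ_[2]) := by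
    intro c
    rw [iwasawaToPowerSeries, PowerSeries.map_C]
    rfl
  have hE : (PowerSeries.C ϖ₀ * g : IwasawaAlgebra 2) = PowerSeries.C (((2 : ℕ) : ℤ_[2]) ^ m) * L₀ := by
    apply iwasawaToPowerSeries_injective 2
    have h2m : (((((2 : ℕ) : ℤ_[2])) ^ m : ℤ_[2]) : ℚ_[2]) = 2 ^ m := by norm_cast
    rw [map_mul, map_mul, hιC, hιC, hιg, hL₀, hϖ₀, h2m, ← mul_assoc, ← mul_assoc, ← map_mul, ← map_mul]
    congr 2
    ring
  -- (2) `μ(L₀) = 0` from the analytic certificate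
  obtain ⟨k, hk⟩ := hμan f hf ϖ hϖ L (fun hsp => absurd hsp hns) (fun _ => hLf)
  rw [← hL₀] at hk
  have hμL₀ : mu L₀ = 0 := Nat.le_zero.mp (mu_le_of_lt_norm_coeff hk)
  have hL₀0 : L₀ ≠ 0 := by
    rintro rfl
    rw [map_zero, map_zero, norm_zero] at hk
    exact not_le.mpr hk (by positivity)
  -- (3) the case `m = 0`: the ideal absorbs `ϖ₀`
  rcases Nat.le_one_iff_eq_zero_or_eq_one.mp hm with rfl | rfl
  · rw [pow_zero, map_one, one_mul] at hE
    rw [← hE]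
    exact Ideal.mul_mem_left _ _ hg
  -- (4) the case `m = 1`: `char X = (f_X)`, `μ(f_X) = 0`, and `μ(b) = 1` in `ϖ₀·g = f_X·b = 2·L₀`
  rw [pow_one] at hE
  haveI : (Module.charIdeal (IwasawaAlgebra 2) D.X).IsPrincipal := charIdeal_isPrincipal_holds 2 D.X
  obtain ⟨fX, hfX⟩ := Submodule.IsPrincipal.principal (Module.charIdeal (IwasawaAlgebra 2) D.X)
  have hchar : D.charIdeal = Ideal.span {fX} := hfX
  have hfX0 : fX ≠ 0 := by
    intro h0
    refine Module.charIdeal_ne_bot (IwasawaAlgebra 2) D.X ?_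
    change D.charIdeal = ⊥
    rw [hchar, h0]
    exact Ideal.span_singleton_eq_bot.mpr rfl
  have hg' : PowerSeries.C ϖ₀ * g ∈ D.charIdeal := Ideal.mul_mem_left _ _ hg
  rw [hchar] at hg'
  obtain ⟨b, hb⟩ := Ideal.mem_span_singleton'.mp hg'
  have hfac : PowerSeries.C ((2 : ℕ) : ℤ_[2]) * L₀ = fX * b := by rw [mul_comm fX, hb, hE]
  have h2L₀0 : (PowerSeries.C ((2 : ℕ) : ℤ_[2]) * L₀ : IwasawaAlgebra 2) ≠ 0 :=
    mul_ne_zero (by rw [← pow_one ((2 : ℕ) : ℤ_[2])]; exact C_pow_ne_zero 1) hL₀0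
  have hb0 : b ≠ 0 := by rintro rfl; exact h2L₀0 (by rw [hfac, mul_zero])
  have hμfX : mu fX = 0 := by
    rw [mu_generator_eq_muInvariant D.X hX hfX0 hchar]
    exact hμX
  have hred : red L₀ ≠ 0 := by
    intro h0
    have hdvd : PowerSeries.C (((2 : ℕ) : ℤ_[2]) ^ 1) ∣ L₀ := by
      rw [pow_one]; exact (red_eq_zero_iff L₀).mp h0
    have := le_mu_of_C_pow_dvd hL₀0 hdvd
    omega
  have hμ2L₀ : mu (PowerSeries.C ((2 : ℕ) : ℤ_[2]) * L₀ : IwasawaAlgebra 2) = 1 :=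
    (mu_eq_and_pfree_eq (a := 1) hred (by rw [pow_one])).1
  have hμb : mu b = 1 := by
    have h := mu_mul hfX0 hb0
    rw [← hfac, hμ2L₀, hμfX, zero_add] at h
    exact h.symm
  have hbeq : b = PowerSeries.C ((2 : ℕ) : ℤ_[2]) * pfree b := by
    have h := eq_C_pow_mu_mul_pfree b
    rwa [hμb, pow_one] at h
  have hfac' : L₀ = fX * pfree b := by
    have h : PowerSeries.C ((2 : ℕ) : ℤ_[2]) * L₀ = PowerSeries.C ((2 : ℕ) : ℤ_[2]) * (fX * pfree b) := by
      rw [hfac]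
      conv_lhs => rw [hbeq]
      ring
    exact mul_left_cancel₀ (by rw [← pow_one ((2 : ℕ) : ℤ_[2])]; exact C_pow_ne_zero 1) h
  rw [hchar, hfac']
  exact Ideal.mul_mem_right _ _ (Ideal.mem_span_singleton_self fX)

/-! ## §2 Door (34-INT-pinch-ns⁺): `BSD₂(E)` and the rank-`0` `2`-converse from the slack-one datum plus `μ(X) = 0` -/

/-- **DOOR (34-INT-pinch-ns⁺), non-split `E` with `E[2]` irreducible, `Δ(E) > 0` allowed (PROVED modulo
the displayed inputs): `BSDp W 2`, both halves.** Binders: PRINT {A235-twin `h41`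
(`…_anyPrime_oddLocalDegree`, D-audit remedy of 2026-08-26), modularity `hmod`, GZK}; MEMO {the Kato datum
AT SLACK ONE `hK1 : KatoDivisibilityAtTwoMultUpTo W 1 f (−1) L` (PROOF-KATO2MULT Thm. A with `c_∞ ≤ 2`;
mult-2's binder), the Selmer `λ`-lower-bound `hlow` (ibid. §6.2)}; the HYPOTHESIS
`hμX : μ(X(E/ℚ_∞)) = 0` for every cyclotomic dual datum with `X` torsion (Greenberg's `μ`-conjecture for
`E[2]` irreducible read at `2` — NOT asserted, not discharged; it is exactly the factor `2 = c_∞` of the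
slack); CERTIFICATES {`λ_an(E) = n` (`hlan`), `μ_an(E) = 0` (`hμan`), `hper₀ : 0 ≤ ord₂ ϖ`}; the curve's
decidable data {`Mult W 2`, non-split, `TwoAdicSurjective W`}; analytic rank `0`. Chain: INT2-AUTO-ns
(`exists_iwasawaToPowerSeries_eq_C_mul_of_isMultPAdicLFunctionOf_neg_one_two`) ⇒ `ι L₀ = ϖ·L`; §1 ⇒
`L₀ ∈ char X`; `charIdeal_eq_span_of_katoInt_selmerPinch_nonsplit` ⇒ `char X = (L₀)`;
`missingPPartAt_two_nonsplit_of_charIdeal_eq_span` (A235-twin glue, `l_v = 2`) ⇒ `ord₂ #Ш_an = ord₂ #Ш`.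
[cite: GreenbergLNM1716, §4 pp. 112–113 (non-split l_v = 2), Conj. 1.11 and Prop. 4.14 (p. 124)]
[cite: MazurTateTeitelbaum1986Invent, §I.10 and §I.14] [cite: Miller2011LMS, Def. 1.1 and §1] -/
theorem bsdp_two_nonsplit_of_katoUpToOnePinch_of_mu {n : ℕ}
    (h41 : thm41Analogue_charValue_rankZero_numberField_anyPrime_oddLocalDegree)
    (hmod : nonempty_modularParametrizationData)
    (hGZK : rank_eq_analyticRank_of_analyticRank_le_one)
    (hK1 : ∀ {N : ℕ} [NeZero N] (f : CuspForm (Gamma0 N) 2) (L : PowerSeries ℚ_[2]),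
      KatoDivisibilityAtTwoMultUpTo W 1 f (-1) L)
    (hμX : ∀ (κ : ZpExtension ℚ 2) (γ : Field.absoluteGaloisGroup ℚ), κ.IsCyclotomic →
      κ.IsTopGenerator γ → IsCyclotomicVariable 2 γ → ∀ D : W.SelmerDualData κ γ, D.IsTorsion → D.mu = 0)
    (hlow : SelmerLambdaLowerBoundAtTwo W n)
    (hper₀ : ∀ [NeZero (W.conductorNorm ℤ)] (f : CuspForm (Gamma0 (W.conductorNorm ℤ)) 2),
      IsNewformOf W f → ∀ ϖ : ℚ, (ϖ : ℝ) * W.realPeriodRat = plusPeriod f → 0 ≤ padicValRat 2 ϖ)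
    (hr : W.analyticRank = 0) (hmult : Mult W 2) (hns : ¬ W.HasSplitMultiplicativeReductionAtPrime 2)
    (him : TwoAdicSurjective W)
    (hlan : X2.AnalyticLambdaEq W 2 n) (hμan : X2.AnalyticMuLE W 2 0) : BSDp W 2 := by
  haveI : NeZero (W.conductorNorm ℤ) := ⟨(W.conductorNorm_pos_holds).ne'⟩
  obtain ⟨Dm⟩ := hmod W
  have hf : IsNewformOf W Dm.f := Dm.isNewformOf
  have hL : W.entireLFunction 1 ≠ 0 :=
    (W.analyticRank_eq_zero_iff_holds hf.hasEntireLFunction).mp hr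
  obtain ⟨ϖ, -, hϖ, -⟩ := Dm.exists_rat_mul_realPeriodRat_eq_plusPeriod
  obtain ⟨κ, hκ, γ, hγ, hγ'⟩ := exists_isCyclotomic_isTopGenerator_isCyclotomicVariable_holds 2
  obtain ⟨DW⟩ := W.nonempty_selmerDualData_holds κ γ hγ
  obtain ⟨L, hLf⟩ := exists_isMultPAdicLFunctionOf_neg_one_of_nonsplit hf hmult hns
  have hϖnorm : ‖((ϖ : ℚ) : ℚ_[2])‖ ≤ 1 := by
    have h := hper₀ Dm.f hf ϖ hϖ
    by_cases h0 : ϖ = 0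
    · subst h0; simp
    have hϖQ : ((ϖ : ℚ) : ℚ_[2]) ≠ 0 := by exact_mod_cast h0
    rw [Padic.norm_eq_zpow_neg_valuation hϖQ, Padic.valuation_ratCast]
    exact zpow_le_one_of_nonpos₀ (by norm_num) (by linarith)
  let ϖ₀ : ℤ_[2] := ⟨((ϖ : ℚ) : ℚ_[2]), hϖnorm⟩
  obtain ⟨G, hG⟩ := exists_iwasawaToPowerSeries_eq_of_isMultPAdicLFunctionOf_neg_one_two hf hmult hns hLf
  have hL₀ : iwasawaToPowerSeries 2 ((PowerSeries.C ϖ₀ : IwasawaAlgebra 2) * G) =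
      PowerSeries.C (ϖ : ℚ_[2]) * L := by
    rw [map_mul, hG, iwasawaToPowerSeries, PowerSeries.map_C]
    rfl
  obtain ⟨hX, m, g, hm, hg, hιg⟩ := hK1 Dm.f L κ γ hκ hγ hγ' hmult (Or.inr ⟨hns, rfl⟩) hf hLf him DW
  have hKL₀ := mem_charIdeal_of_katoUpToOne_nonsplit_of_mu W hns hμan hγ hf hLf DW hX
    (hμX κ γ hκ hγ hγ' DW hX) hϖ (ϖ₀ := ϖ₀) rfl hg hm hιg hL₀
  have hchar := charIdeal_eq_span_of_katoInt_selmerPinch_nonsplit W hns hlan hμan hκ hγ hγ' hf hLf DW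
    hX hϖ hL₀ hKL₀ hlow
  exact bsdp_of_missingPPartAt W 2 hGZK (by rw [hr]; exact zero_le_one)
    (missingPPartAt_two_nonsplit_of_charIdeal_eq_span W
      (twoAdicEulerCharRankZeroNonsplitMult_zero_of_greenberg' W h41) hGZK hmult hns hL hκ hγ hγ' hf hLf
      DW hX hϖ hL₀ hchar)

/-- **DOOR (34-INT-pinch-ns⁺), CONVERSE FORM (PROVED modulo the displayed inputs):** with the same inputs
MINUS analytic rank `0` and GZK, `Sel_{2^∞}(E/ℚ)` finite ⇒ `L(E,1) ≠ 0 ∧ r_an(E) = 0`.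
[cite: GreenbergLNM1716, §4 pp. 112–113, Conj. 1.11 and Prop. 4.14 (p. 124)]
[cite: MazurTateTeitelbaum1986Invent, §I.14] -/
theorem analyticRank_eq_zero_of_finite_selmer_of_katoUpToOneNonsplitPinch_of_mu {n : ℕ}
    (h41 : thm41Analogue_charValue_rankZero_numberField_anyPrime_oddLocalDegree)
    (hmod : nonempty_modularParametrizationData)
    (hK1 : ∀ {N : ℕ} [NeZero N] (f : CuspForm (Gamma0 N) 2) (L : PowerSeries ℚ_[2]),
      KatoDivisibilityAtTwoMultUpTo W 1 f (-1) L)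
    (hμX : ∀ (κ : ZpExtension ℚ 2) (γ : Field.absoluteGaloisGroup ℚ), κ.IsCyclotomic →
      κ.IsTopGenerator γ → IsCyclotomicVariable 2 γ → ∀ D : W.SelmerDualData κ γ, D.IsTorsion → D.mu = 0)
    (hlow : SelmerLambdaLowerBoundAtTwo W n)
    (hper₀ : ∀ [NeZero (W.conductorNorm ℤ)] (f : CuspForm (Gamma0 (W.conductorNorm ℤ)) 2),
      IsNewformOf W f → ∀ ϖ : ℚ, (ϖ : ℝ) * W.realPeriodRat = plusPeriod f → 0 ≤ padicValRat 2 ϖ)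
    (hmult : Mult W 2) (hns : ¬ W.HasSplitMultiplicativeReductionAtPrime 2) (him : TwoAdicSurjective W)
    (hlan : X2.AnalyticLambdaEq W 2 n) (hμan : X2.AnalyticMuLE W 2 0)
    (hfin : Finite (W.selmerGroupPInfty 2)) : W.entireLFunction 1 ≠ 0 ∧ W.analyticRank = 0 := by
  haveI : NeZero (W.conductorNorm ℤ) := ⟨(W.conductorNorm_pos_holds).ne'⟩
  obtain ⟨Dm⟩ := hmod W
  have hf : IsNewformOf W Dm.f := Dm.isNewformOf
  obtain ⟨ϖ, -, hϖ, -⟩ := Dm.exists_rat_mul_realPeriodRat_eq_plusPeriod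
  obtain ⟨κ, hκ, γ, hγ, hγ'⟩ := exists_isCyclotomic_isTopGenerator_isCyclotomicVariable_holds 2
  obtain ⟨DW⟩ := W.nonempty_selmerDualData_holds κ γ hγ
  obtain ⟨L, hLf⟩ := exists_isMultPAdicLFunctionOf_neg_one_of_nonsplit hf hmult hns
  have hϖnorm : ‖((ϖ : ℚ) : ℚ_[2])‖ ≤ 1 := by
    have h := hper₀ Dm.f hf ϖ hϖ
    by_cases h0 : ϖ = 0
    · subst h0; simp
    have hϖQ : ((ϖ : ℚ) : ℚ_[2]) ≠ 0 := by exact_mod_cast h0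
    rw [Padic.norm_eq_zpow_neg_valuation hϖQ, Padic.valuation_ratCast]
    exact zpow_le_one_of_nonpos₀ (by norm_num) (by linarith)
  let ϖ₀ : ℤ_[2] := ⟨((ϖ : ℚ) : ℚ_[2]), hϖnorm⟩
  obtain ⟨G, hG⟩ := exists_iwasawaToPowerSeries_eq_of_isMultPAdicLFunctionOf_neg_one_two hf hmult hns hLf
  have hL₀ : iwasawaToPowerSeries 2 ((PowerSeries.C ϖ₀ : IwasawaAlgebra 2) * G) =
      PowerSeries.C (ϖ : ℚ_[2]) * L := by
    rw [map_mul, hG, iwasawaToPowerSeries, PowerSeries.map_C]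
    rfl
  obtain ⟨hX, m, g, hm, hg, hιg⟩ := hK1 Dm.f L κ γ hκ hγ hγ' hmult (Or.inr ⟨hns, rfl⟩) hf hLf him DW
  have hKL₀ := mem_charIdeal_of_katoUpToOne_nonsplit_of_mu W hns hμan hγ hf hLf DW hX
    (hμX κ γ hκ hγ hγ' DW hX) hϖ (ϖ₀ := ϖ₀) rfl hg hm hιg hL₀
  have hchar := charIdeal_eq_span_of_katoInt_selmerPinch_nonsplit W hns hlan hμan hκ hγ hγ' hf hLf DW
    hX hϖ hL₀ hKL₀ hlow
  exact entireLFunction_one_ne_zero_of_finite_selmer_of_charIdeal_eq_span_nonsplit W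
    (twoAdicEulerCharRankZeroNonsplitMult_zero_of_greenberg' W h41) hmult hns hκ hγ hγ' hf hLf DW hX hL₀
    hchar hfin

end Summit.BirchSwinnertonDyer.Rank1Residual.X5.O1

end
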